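import Literature.AlgebraicGeometry.HodgeTheory.WeilTypeFourfoldTimesCMCurveSquaredBlockData
import Literature.AlgebraicGeometry.Motives.HodgeThetaSubalgebraUnitaryTransfer
import HarnessLib

/-!
# Block data of the blocked Lie → group socket at `A = Y₅ × E_k` for the CONSTRUCTED blocking endomorphism
# `φ_E := diag(φ_Y, 2χ)` (TABLE X row 17; cell `pub-hodgeav-hg6`, eng-3 g4, brick E17a)

For a product `Y × E` of complex abelian varieties with `φ_Y ≫ φ_Y = −d` on `Y` and `χ ≫ χ = −d` on `E` (`d > 0`), the
endomorphism `φ_E := diag(φ_Y, 2χ)` of `Y × E` has, on `H¹(Y × E; ℚ) ⊗ ℂ = pr₁^* H¹(Y)_ℂ ⊕ pr₂^* H¹(E)_ℂ` (Künneth in degree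
one), the four eigenvalues `± i√d` (eigenspaces `pr₁^* W_{±i√d}(φ_Y)`) and `± 2i√d` (eigenspaces `pr₂^* W_{±i√d}(χ)`): the
«colours» `μ_k = (k+1)·i√d`, `k ∈ Fin 2`, and their conjugates. This file DERIVES, from `φ_Y ≫ φ_Y = −d`, `χ ≫ χ = −d`,
`0 < dim Y`, `0 < dim E` only, the block data that the blocked socket
`IsWeilType.mem_hodgeGroupOne_of_mem_unitaryCentralizerGroup_blocked_of_hodgeLieC` (`WeilTypeBlockedHodgeGroupOfLie`) displays:
the four blocks are non-zero (§2 `eigenspace_colour₀_ne_bot`, `eigenspace_colour₁_ne_bot`, both signs), they span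
(`sup_eigenspace_colour_eq_top`), and each lies in the corresponding eigenspace of the diagonal Weil operator `Φ = diag(φ_Y, χ)`
(`eigenspace_colour_le`, both signs); the colours are injective and never conjugate to each other (§1). §0 proves the general
two-factor Künneth eigenvector lemma `mem_eigenspace_blockDiag_iff` on `A × B` (the tree's
`CMCurveSqFourfold.mem_eigenspace_blockDiag₃_iff` is the three-block version on `Y × (E × E)`; the `E × E` instance is E1b's) and
`eigenspace_baseChange_ne_bot` (both eigenspaces `W_{±i√d}(φ^*_ℂ)` of an endomorphism with `φ ≫ φ = −d` on a positive-dimensional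
abelian variety are non-zero: `dim W_{i√d} = dim A`, and complex conjugation carries `W_{i√d}` onto `W_{−i√d}`).
KERNEL ONLY: no definition, no `sorry`, no named fact; HC ∕ HC_AV are not mentioned. Socket-shaped packaging (index
`Fin 2 × Fin 2`, `if`-colours, `finrank End⁰ = 4`) is the sequel `WeilTypeFivefoldTimesCMCurveBlockDataSocket`.

## References
* [MoonenZarhin1999LowDim] B. Moonen, Yu. Zarhin, Math. Ann. 315 (1999), §2 (2.1), (2.4) and §5 (5.2)–(5.3).
* [VoisinHodgeI2002] C. Voisin, Hodge Theory and Complex Algebraic Geometry I (2002), §11.3.3 Thm. 11.38 (Künneth).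
* [Deligne1982HodgeCycles] P. Deligne, LNM 900 (1982), §4 p. 30 (conjugation exchanges `H_σ` and `H_σ̄`).
* [LangeBirkenhake1992] H. Lange, Ch. Birkenhake, Complex Abelian Varieties (1992), §1.1 Prop. 1.1.9.
-/

noncomputable section

open scoped TensorProduct
open CategoryTheory Module

namespace Literature.AlgebraicGeometry.HodgeTheory

open Literature.AlgebraicTopology.SingularHomology
open Literature.AlgebraicGeometry.Motives (AbelianVariety bettiCohomology)
open Literature.AlgebraicGeometry.Motives.AbelianVariety (fst snd prod_hom_ext)
open Literature.AlgebraicGeometry.Motives.HodgeStructure (conj_conj UnitaryTheta.conj_mem_eigenspace_iff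
  UnitaryTheta.isCompl_eigenspace UnitaryTheta.conj_eq_neg_of_sq)
open Literature.AlgebraicGeometry.Milne1999.CMTypeProducts (blockDiag)
open Literature.AlgebraicGeometry.ComplexMultiplication (bettiCohomology_map_nsmul_one)
open HOneProduct

/-! ### §0 Plumbing and the two-factor Künneth eigenvector lemma -/

section Plumbing

variable {A B : AbelianVariety ℂ}

/-- `(n • f)^* = n • f^*` on `H¹(−; ℚ)`. [folklore] -/
private theorem pull_nsmul₂ (n : ℕ) (f : A ⟶ B) :
    (bettiCohomology.map (n • f).hom.hom.hom 1).hom = (n : ℚ) • (bettiCohomology.map f.hom.hom.hom 1).hom := by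
  rw [bettiCohomology_map_nsmul_one, ModuleCat.hom_nsmul, Nat.cast_smul_eq_nsmul]

/-- `(q : ℂ) • z = q • z` on `V_ℂ`. [folklore] -/
private theorem ratCast_smul₅ {V : Type*} [AddCommGroup V] [Module ℚ V] (q : ℚ) (z : ℂ ⊗[ℚ] V) :
    (q : ℂ) • z = q • z := by
  rw [← algebraMap_smul ℂ q z, eq_ratCast]

/-- `(n • f) ≫ (n • f) = −(n²e)` when `f ≫ f = −e`. [folklore] -/
private theorem nsmul_comp_nsmul_eq₂ {f : A ⟶ A} {e : ℕ} (hf : f ≫ f = -(e • 𝟙 A)) (n : ℕ) :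
    (n • f) ≫ (n • f) = -((n * n * e) • 𝟙 A) := by
  rw [Preadditive.nsmul_comp, Preadditive.comp_nsmul, hf, smul_neg, smul_neg, smul_smul, smul_smul]

/-- `(n • g)^*_ℂ x = (n c) x ↔ g^*_ℂ x = c x` (`n ≠ 0`). [folklore] -/
private theorem mem_eigenspace_nsmul_iff₂ {g : A ⟶ A} {n : ℕ} (hn : n ≠ 0) (c : ℂ)
    (x : ℂ ⊗[ℚ] bettiCohomology A.X 1) :
    x ∈ Module.End.eigenspace (((bettiCohomology.map (n • g).hom.hom.hom 1).hom).baseChange ℂ) ((n : ℂ) * c) ↔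
      x ∈ Module.End.eigenspace (((bettiCohomology.map g.hom.hom.hom 1).hom).baseChange ℂ) c := by
  rw [Module.End.mem_eigenspace_iff, Module.End.mem_eigenspace_iff, pull_nsmul₂, LinearMap.baseChange_smul,
    LinearMap.smul_apply, ← ratCast_smul₅, Rat.cast_natCast, mul_smul]
  exact (smul_right_injective _ (Nat.cast_ne_zero.2 hn)).eq_iff

/-- `(i√d)·(i√d) = −d`. [folklore] -/
private theorem rootColour_mul_self (d : ℕ) :
    (Complex.I * (Real.sqrt d : ℂ)) * (Complex.I * (Real.sqrt d : ℂ)) = -(d : ℂ) := by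
  rw [mul_mul_mul_comm, Complex.I_mul_I, ← Complex.ofReal_mul, Real.mul_self_sqrt (Nat.cast_nonneg d),
    Complex.ofReal_natCast, neg_one_mul]

/-- `c = ± i√d ⟹ c·c = −d`. [folklore] -/
private theorem mul_self_of_eq_or (d : ℕ) {c : ℂ}
    (hc : c = Complex.I * (Real.sqrt d : ℂ) ∨ c = -(Complex.I * (Real.sqrt d : ℂ))) : c * c = -(d : ℂ) := by
  rcases hc with rfl | rfl
  · exact rootColour_mul_self d
  · rw [neg_mul_neg]; exact rootColour_mul_self d

/-- **The pull-back of `diag(f, g)` in the two Künneth components of `H¹(A × B) ⊗ ℂ`.**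
[cite: VoisinHodgeI2002, §11.3.3 Thm. 11.38] -/
theorem CMCurveFivefold.pull_blockDiag_baseChange_apply (f : A ⟶ A) (g : B ⟶ B)
    (v : ℂ ⊗[ℚ] bettiCohomology (A.prod B).X 1) :
    ((bettiCohomology.map (blockDiag A B f g).hom.hom.hom 1).hom).baseChange ℂ v =
      (pullFst A B).baseChange ℂ ((((bettiCohomology.map f.hom.hom.hom 1).hom).baseChange ℂ)
        ((pullInl A B).baseChange ℂ v)) +
      (pullSnd A B).baseChange ℂ ((((bettiCohomology.map g.hom.hom.hom 1).hom).baseChange ℂ)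
        ((pullInr A B).baseChange ℂ v)) := by
  have h := pull_blockDiag (A := A) (B := B) f g
  change (bettiCohomology.map (blockDiag A B f g).hom.hom.hom 1).hom = _ at h
  rw [h]
  simp only [LinearMap.baseChange_add, LinearMap.baseChange_comp, LinearMap.add_apply, LinearMap.comp_apply]

/-- **Two-factor Künneth eigenvector lemma**: `v ∈ H¹(A × B) ⊗ ℂ` is a `c`-eigenvector of `diag(f, g)^*_ℂ` iff its two
Künneth components `ι₁^* v`, `ι₂^* v` are `c`-eigenvectors of `f^*_ℂ`, `g^*_ℂ`. [cite: VoisinHodgeI2002, §11.3.3 Thm. 11.38]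
[cite: MoonenZarhin1999LowDim, §5 (5.2)] -/
theorem CMCurveFivefold.mem_eigenspace_blockDiag_iff (f : A ⟶ A) (g : B ⟶ B) (c : ℂ)
    (v : ℂ ⊗[ℚ] bettiCohomology (A.prod B).X 1) :
    v ∈ Module.End.eigenspace (((bettiCohomology.map (blockDiag A B f g).hom.hom.hom 1).hom).baseChange ℂ) c ↔
      (pullInl A B).baseChange ℂ v ∈ Module.End.eigenspace (((bettiCohomology.map f.hom.hom.hom 1).hom).baseChange ℂ) c ∧
        (pullInr A B).baseChange ℂ v ∈
          Module.End.eigenspace (((bettiCohomology.map g.hom.hom.hom 1).hom).baseChange ℂ) c := by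
  simp only [Module.End.mem_eigenspace_iff]
  constructor
  · intro hv
    rw [CMCurveFivefold.pull_blockDiag_baseChange_apply] at hv
    have h1 := congrArg ((pullInl A B).baseChange ℂ) hv
    have h2 := congrArg ((pullInr A B).baseChange ℂ) hv
    simp only [map_add, map_smul, pullInl_pullFst_baseChange, pullInl_pullSnd_baseChange, pullInr_pullSnd_baseChange,
      pullInr_pullFst_baseChange, add_zero, zero_add] at h1 h2
    exact ⟨h1, h2⟩
  · rintro ⟨h1, h2⟩
    have hv : v = (pullFst A B).baseChange ℂ ((pullInl A B).baseChange ℂ v) +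
        (pullSnd A B).baseChange ℂ ((pullInr A B).baseChange ℂ v) := by rw [pullFst_pullInl_add_baseChange]
    conv_lhs => rw [CMCurveFivefold.pull_blockDiag_baseChange_apply, h1, h2]
    conv_rhs => rw [hv]
    rw [map_smul, map_smul, smul_add]

/-- **Both eigenspaces `W_{± i√d}(φ^*_ℂ)` are non-zero** for `φ ≫ φ = −d` (`d > 0`) on a positive-dimensional abelian
variety: `dim_ℂ W_{i√d} = dim A > 0`, and complex conjugation carries `W_{i√d}` into `W_{−i√d}`.
[cite: LangeBirkenhake1992, §1.1 Prop. 1.1.9 (p. 20)] [cite: Deligne1982HodgeCycles, §4 (p. 30)] -/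
theorem CMCurveFivefold.eigenspace_baseChange_ne_bot {φ : A ⟶ A} {d : ℕ} (hd : 0 < d) (h0 : 0 < A.dim)
    (hφ : φ ≫ φ = -(d • 𝟙 A)) {c : ℂ}
    (hc : c = Complex.I * (Real.sqrt d : ℂ) ∨ c = -(Complex.I * (Real.sqrt d : ℂ))) :
    Module.End.eigenspace (((bettiCohomology.map φ.hom.hom.hom 1).hom).baseChange ℂ) c ≠ ⊥ := by
  have hfin := CMCurveSqFourfold.finrank_eigenspace_baseChange_eq_dim hd hφ
  have hne : Module.End.eigenspace (((bettiCohomology.map φ.hom.hom.hom 1).hom).baseChange ℂ)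
      (Complex.I * (Real.sqrt d : ℂ)) ≠ ⊥ := by
    intro h
    rw [h, finrank_bot] at hfin
    omega
  rcases hc with rfl | rfl
  · exact hne
  · obtain ⟨w, hw, hw0⟩ := (Submodule.ne_bot_iff _).1 hne
    have hμc : starRingEnd ℂ (Complex.I * (Real.sqrt d : ℂ)) = -(Complex.I * (Real.sqrt d : ℂ)) := by
      rw [map_mul, Complex.conj_I, Complex.conj_ofReal, neg_mul]
    refine (Submodule.ne_bot_iff _).2 ⟨Motives.HodgeStructure.conj w,
      (UnitaryTheta.conj_mem_eigenspace_iff _ hμc w).2 hw, fun h => hw0 ?_⟩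
    rw [← conj_conj w, h, map_zero]

end Plumbing

/-! ### §1 The colours `(k+1)·i√d` and the eigenvectors of `φ_E = diag(φ_Y, 2χ)` -/

section Colours

variable {Y E : AbelianVariety ℂ} {d : ℕ} {φY : Y ⟶ Y} {χ : E ⟶ E}

/-- The colours `(k+1)·i√d`, `k ∈ Fin 2`, are pairwise distinct. [cite: MoonenZarhin1999LowDim, §5 (5.2)–(5.3)] -/
theorem CMCurveFivefold.colour_injective (hd : 0 < d) :
    Function.Injective (fun k : Fin 2 => ((k : ℕ) + 1 : ℂ) * (Complex.I * (Real.sqrt d : ℂ))) := by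
  intro k k' h
  have hμ0 : Complex.I * (Real.sqrt d : ℂ) ≠ 0 := mul_ne_zero Complex.I_ne_zero
    (Complex.ofReal_ne_zero.2 (Real.sqrt_ne_zero'.2 (Nat.cast_pos.2 hd)))
  have h1 := mul_right_cancel₀ hμ0 h
  have h2 : ((k : ℕ) : ℂ) = ((k' : ℕ) : ℂ) := add_right_cancel h1
  exact Fin.ext (by exact_mod_cast h2)

/-- The conjugate of a colour: `conj ((k+1)·i√d) = (k+1)·(−i√d)`. [cite: Deligne1982HodgeCycles, §4 (p. 30)] -/
theorem CMCurveFivefold.starRingEnd_colour (d : ℕ) (k : Fin 2) :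
    starRingEnd ℂ (((k : ℕ) + 1 : ℂ) * (Complex.I * (Real.sqrt d : ℂ))) =
      ((k : ℕ) + 1 : ℂ) * (-(Complex.I * (Real.sqrt d : ℂ))) := by
  rw [map_mul, map_mul, Complex.conj_I, Complex.conj_ofReal, map_add, map_one, map_natCast, neg_mul]

/-- No colour is conjugate to a colour (all colours lie on the positive imaginary axis).
[cite: MoonenZarhin1999LowDim, §5 (5.2)–(5.3)] [cite: Deligne1982HodgeCycles, §4 (p. 30)] -/
theorem CMCurveFivefold.colour_ne_conj (hd : 0 < d) (k k' : Fin 2) :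
    ((k' : ℕ) + 1 : ℂ) * (Complex.I * (Real.sqrt d : ℂ)) ≠
      starRingEnd ℂ (((k : ℕ) + 1 : ℂ) * (Complex.I * (Real.sqrt d : ℂ))) := by
  intro h
  have hμ0 : Complex.I * (Real.sqrt d : ℂ) ≠ 0 := mul_ne_zero Complex.I_ne_zero
    (Complex.ofReal_ne_zero.2 (Real.sqrt_ne_zero'.2 (Nat.cast_pos.2 hd)))
  rw [CMCurveFivefold.starRingEnd_colour, mul_neg, eq_neg_iff_add_eq_zero, ← add_mul, mul_eq_zero] at h
  have h' : (((k' : ℕ) + 1 + ((k : ℕ) + 1) : ℕ) : ℂ) = 0 := by push_cast; exact h.resolve_right hμ0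
  exact absurd (Nat.cast_eq_zero.1 h') (by omega)

/-- **Eigenvectors of `φ_E = diag(φ_Y, 2χ)` at a root colour `c = ± i√d`**: exactly the first Künneth component survives
(`(2χ)^*` has no eigenvalue `c`, since `(2χ) ≫ (2χ) = −4d`). [cite: MoonenZarhin1999LowDim, §2 (2.1) and §5 (5.2)] -/
theorem CMCurveFivefold.mem_eigenspace_colour₀_iff (hd : 0 < d) (hχ : χ ≫ χ = -(d • 𝟙 E)) {c : ℂ} (hc : c * c = -(d : ℂ))
    (v : ℂ ⊗[ℚ] bettiCohomology (Y.prod E).X 1) :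
    v ∈ Module.End.eigenspace (((bettiCohomology.map (blockDiag Y E φY (2 • χ)).hom.hom.hom 1).hom).baseChange ℂ) c ↔
      (pullInl Y E).baseChange ℂ v ∈ Module.End.eigenspace (((bettiCohomology.map φY.hom.hom.hom 1).hom).baseChange ℂ) c ∧
        (pullInr Y E).baseChange ℂ v = 0 := by
  have h2χ : (2 • χ) ≫ (2 • χ) = -((2 * 2 * d) • 𝟙 E) := nsmul_comp_nsmul_eq₂ hχ 2
  have hne : c * c ≠ -((2 * 2 * d : ℕ) : ℂ) := by
    rw [hc]
    push_cast
    intro h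
    have h3 : (3 : ℂ) * d = 0 := by linear_combination h
    exact absurd (mul_eq_zero.1 h3) (not_or.2 ⟨three_ne_zero, Nat.cast_ne_zero.2 hd.ne'⟩)
  rw [CMCurveFivefold.mem_eigenspace_blockDiag_iff, CMCurveSqFourfold.eigenspace_eq_bot_of_sq_ne h2χ hne, Submodule.mem_bot]

/-- **Eigenvectors of `φ_E = diag(φ_Y, 2χ)` at a doubled colour `2c`, `c = ± i√d`**: exactly the second Künneth component
survives, and it is a `c`-eigenvector of `χ^*` (`φ_Y^*` has no eigenvalue `2c`). [cite: MoonenZarhin1999LowDim, §2 (2.1) and §5 (5.2)] -/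
theorem CMCurveFivefold.mem_eigenspace_colour₁_iff (hd : 0 < d) (hφY : φY ≫ φY = -(d • 𝟙 Y)) {c : ℂ}
    (hc : c * c = -(d : ℂ)) (v : ℂ ⊗[ℚ] bettiCohomology (Y.prod E).X 1) :
    v ∈ Module.End.eigenspace (((bettiCohomology.map (blockDiag Y E φY (2 • χ)).hom.hom.hom 1).hom).baseChange ℂ)
        ((2 : ℂ) * c) ↔
      (pullInl Y E).baseChange ℂ v = 0 ∧
        (pullInr Y E).baseChange ℂ v ∈ Module.End.eigenspace (((bettiCohomology.map χ.hom.hom.hom 1).hom).baseChange ℂ) c := by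
  have hne : (2 : ℂ) * c * ((2 : ℂ) * c) ≠ -(d : ℂ) := by
    rw [mul_mul_mul_comm, hc]
    intro h
    have h3 : (3 : ℂ) * d = 0 := by linear_combination -h
    exact absurd (mul_eq_zero.1 h3) (not_or.2 ⟨three_ne_zero, Nat.cast_ne_zero.2 hd.ne'⟩)
  rw [CMCurveFivefold.mem_eigenspace_blockDiag_iff, CMCurveSqFourfold.eigenspace_eq_bot_of_sq_ne hφY hne, Submodule.mem_bot,
    show ((2 : ℂ) * c) = ((2 : ℕ) : ℂ) * c by rw [Nat.cast_ofNat], mem_eigenspace_nsmul_iff₂ two_ne_zero]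

end Colours

/-! ### §2 The block data: inclusion in the Weil eigenspaces, non-vanishing, spanning -/

section BlockData

variable {Y E : AbelianVariety ℂ} {d : ℕ} {φY : Y ⟶ Y} {χ : E ⟶ E}

/-- **hKE ∕ hKE′ (root colour)**: `W_c(φ_E) ⊆ W_c(Φ)` for the diagonal Weil operator `Φ = diag(φ_Y, χ)` and `c = ± i√d`.
[cite: MoonenZarhin1999LowDim, §5 (5.2)] -/
theorem CMCurveFivefold.eigenspace_colour₀_le (hd : 0 < d) (hχ : χ ≫ χ = -(d • 𝟙 E))
    {Φ : Y.prod E ⟶ Y.prod E} (hΦ₁ : Φ ≫ fst Y E = fst Y E ≫ φY) (hΦ₂ : Φ ≫ snd Y E = snd Y E ≫ χ)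
    {c : ℂ} (hc : c * c = -(d : ℂ)) :
    Module.End.eigenspace (((bettiCohomology.map (blockDiag Y E φY (2 • χ)).hom.hom.hom 1).hom).baseChange ℂ) c ≤
      Module.End.eigenspace (((bettiCohomology.map Φ.hom.hom.hom 1).hom).baseChange ℂ) c := by
  intro v hv
  have hΦ := CMCurveSqFourfold.eq_blockDiag_of_comp hΦ₁ hΦ₂
  subst hΦ
  have hv' := (CMCurveFivefold.mem_eigenspace_colour₀_iff hd hχ hc v).1 hv
  exact (CMCurveFivefold.mem_eigenspace_blockDiag_iff φY χ c v).2 ⟨hv'.1, by rw [hv'.2]; exact Submodule.zero_mem _⟩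

/-- **hKE ∕ hKE′ (doubled colour)**: `W_{2c}(φ_E) ⊆ W_c(Φ)`, `c = ± i√d`. [cite: MoonenZarhin1999LowDim, §5 (5.2)] -/
theorem CMCurveFivefold.eigenspace_colour₁_le (hd : 0 < d) (hφY : φY ≫ φY = -(d • 𝟙 Y))
    {Φ : Y.prod E ⟶ Y.prod E} (hΦ₁ : Φ ≫ fst Y E = fst Y E ≫ φY) (hΦ₂ : Φ ≫ snd Y E = snd Y E ≫ χ)
    {c : ℂ} (hc : c * c = -(d : ℂ)) :
    Module.End.eigenspace (((bettiCohomology.map (blockDiag Y E φY (2 • χ)).hom.hom.hom 1).hom).baseChange ℂ)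
        ((2 : ℂ) * c) ≤
      Module.End.eigenspace (((bettiCohomology.map Φ.hom.hom.hom 1).hom).baseChange ℂ) c := by
  intro v hv
  have hΦ := CMCurveSqFourfold.eq_blockDiag_of_comp hΦ₁ hΦ₂
  subst hΦ
  have hv' := (CMCurveFivefold.mem_eigenspace_colour₁_iff hd hφY hc v).1 hv
  exact (CMCurveFivefold.mem_eigenspace_blockDiag_iff φY χ c v).2 ⟨by rw [hv'.1]; exact Submodule.zero_mem _, hv'.2⟩

/-- **hWne (root colours)**: `W_{± i√d}(φ_E) ⊇ pr₁^* W_{± i√d}(φ_Y) ≠ 0` (`dim Y > 0`).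
[cite: MoonenZarhin1999LowDim, §5 (5.2)] [cite: LangeBirkenhake1992, §1.1 Prop. 1.1.9 (p. 20)] -/
theorem CMCurveFivefold.eigenspace_colour₀_ne_bot (hd : 0 < d) (h0Y : 0 < Y.dim) (hφY : φY ≫ φY = -(d • 𝟙 Y))
    (hχ : χ ≫ χ = -(d • 𝟙 E)) {c : ℂ}
    (hc : c = Complex.I * (Real.sqrt d : ℂ) ∨ c = -(Complex.I * (Real.sqrt d : ℂ))) :
    Module.End.eigenspace (((bettiCohomology.map (blockDiag Y E φY (2 • χ)).hom.hom.hom 1).hom).baseChange ℂ) c ≠ ⊥ := by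
  obtain ⟨w, hw, hw0⟩ := (Submodule.ne_bot_iff _).1 (CMCurveFivefold.eigenspace_baseChange_ne_bot hd h0Y hφY hc)
  rw [Submodule.ne_bot_iff]
  refine ⟨(pullFst Y E).baseChange ℂ w, ?_, fun h => hw0 (pullFst_baseChange_injective (by rw [h, map_zero]))⟩
  rw [CMCurveFivefold.mem_eigenspace_colour₀_iff hd hχ (mul_self_of_eq_or d hc), pullInl_pullFst_baseChange,
    pullInr_pullFst_baseChange]
  exact ⟨hw, rfl⟩

/-- **hWne (doubled colours)**: `W_{± 2i√d}(φ_E) ⊇ pr₂^* W_{± i√d}(χ) ≠ 0` (`dim E > 0`).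
[cite: MoonenZarhin1999LowDim, §5 (5.2)] [cite: LangeBirkenhake1992, §1.1 Prop. 1.1.9 (p. 20)] -/
theorem CMCurveFivefold.eigenspace_colour₁_ne_bot (hd : 0 < d) (h0E : 0 < E.dim) (hφY : φY ≫ φY = -(d • 𝟙 Y))
    (hχ : χ ≫ χ = -(d • 𝟙 E)) {c : ℂ}
    (hc : c = Complex.I * (Real.sqrt d : ℂ) ∨ c = -(Complex.I * (Real.sqrt d : ℂ))) :
    Module.End.eigenspace (((bettiCohomology.map (blockDiag Y E φY (2 • χ)).hom.hom.hom 1).hom).baseChange ℂ)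
      ((2 : ℂ) * c) ≠ ⊥ := by
  obtain ⟨w, hw, hw0⟩ := (Submodule.ne_bot_iff _).1 (CMCurveFivefold.eigenspace_baseChange_ne_bot hd h0E hχ hc)
  rw [Submodule.ne_bot_iff]
  refine ⟨(pullSnd Y E).baseChange ℂ w, ?_, fun h => hw0 (pullSnd_baseChange_injective (by rw [h, map_zero]))⟩
  rw [CMCurveFivefold.mem_eigenspace_colour₁_iff hd hφY (mul_self_of_eq_or d hc), pullInl_pullSnd_baseChange,
    pullInr_pullSnd_baseChange]
  exact ⟨rfl, hw⟩

/-- **htop**: the four blocks `W_{i√d}(φ_E)`, `W_{−i√d}(φ_E)`, `W_{2i√d}(φ_E)`, `W_{−2i√d}(φ_E)` span `H¹(Y × E) ⊗ ℂ`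
(Künneth split `v = pr₁^* ι₁^* v + pr₂^* ι₂^* v`, then `H¹(Y)_ℂ = W_{i√d}(φ_Y) ⊕ W_{−i√d}(φ_Y)`, `H¹(E)_ℂ = W_{i√d}(χ) ⊕ W_{−i√d}(χ)`).
[cite: MoonenZarhin1999LowDim, §5 (5.2)] [cite: VoisinHodgeI2002, §11.3.3 Thm. 11.38] -/
theorem CMCurveFivefold.sup_eigenspace_colour_eq_top (hd : 0 < d) (hφY : φY ≫ φY = -(d • 𝟙 Y))
    (hχ : χ ≫ χ = -(d • 𝟙 E)) :
    (Module.End.eigenspace (((bettiCohomology.map (blockDiag Y E φY (2 • χ)).hom.hom.hom 1).hom).baseChange ℂ)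
        (Complex.I * (Real.sqrt d : ℂ)) ⊔
      Module.End.eigenspace (((bettiCohomology.map (blockDiag Y E φY (2 • χ)).hom.hom.hom 1).hom).baseChange ℂ)
        (-(Complex.I * (Real.sqrt d : ℂ)))) ⊔
    (Module.End.eigenspace (((bettiCohomology.map (blockDiag Y E φY (2 • χ)).hom.hom.hom 1).hom).baseChange ℂ)
        ((2 : ℂ) * (Complex.I * (Real.sqrt d : ℂ))) ⊔
      Module.End.eigenspace (((bettiCohomology.map (blockDiag Y E φY (2 • χ)).hom.hom.hom 1).hom).baseChange ℂ)
        ((2 : ℂ) * -(Complex.I * (Real.sqrt d : ℂ)))) = ⊤ := by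
  set c : ℂ := Complex.I * (Real.sqrt d : ℂ) with hcdef
  have hdQ : (0 : ℚ) < (d : ℚ) := Nat.cast_pos.2 hd
  have hc2 : c ^ 2 = -((d : ℚ) : ℂ) := by rw [sq, Rat.cast_natCast]; exact rootColour_mul_self d
  have hcc : c * c = -(d : ℂ) := rootColour_mul_self d
  have hcc' : -c * -c = -(d : ℂ) := by rw [neg_mul_neg]; exact hcc
  have hY := (UnitaryTheta.isCompl_eigenspace hdQ (bettiMapHom_mul_self hφY) hc2).codisjoint
  have hE := (UnitaryTheta.isCompl_eigenspace hdQ (bettiMapHom_mul_self hχ) hc2).codisjoint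
  rw [codisjoint_iff] at hY hE
  refine Submodule.eq_top_iff'.2 fun v => ?_
  obtain ⟨a₁, ha₁, a₂, ha₂, ha⟩ := Submodule.mem_sup.1
    (show (pullInl Y E).baseChange ℂ v ∈ _ from by rw [hY]; exact Submodule.mem_top)
  obtain ⟨b₁, hb₁, b₂, hb₂, hb⟩ := Submodule.mem_sup.1
    (show (pullInr Y E).baseChange ℂ v ∈ _ from by rw [hE]; exact Submodule.mem_top)
  have hv : v = ((pullFst Y E).baseChange ℂ a₁ + (pullFst Y E).baseChange ℂ a₂) +
      ((pullSnd Y E).baseChange ℂ b₁ + (pullSnd Y E).baseChange ℂ b₂) := by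
    rw [← map_add, ← map_add, ha, hb, pullFst_pullInl_add_baseChange]
  rw [hv]
  refine Submodule.add_mem _ (Submodule.mem_sup_left (Submodule.add_mem _ (Submodule.mem_sup_left ?_)
    (Submodule.mem_sup_right ?_))) (Submodule.mem_sup_right (Submodule.add_mem _ (Submodule.mem_sup_left ?_)
    (Submodule.mem_sup_right ?_)))
  · rw [CMCurveFivefold.mem_eigenspace_colour₀_iff hd hχ hcc, pullInl_pullFst_baseChange, pullInr_pullFst_baseChange]
    exact ⟨ha₁, rfl⟩
  · rw [CMCurveFivefold.mem_eigenspace_colour₀_iff hd hχ hcc', pullInl_pullFst_baseChange, pullInr_pullFst_baseChange]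
    exact ⟨ha₂, rfl⟩
  · rw [CMCurveFivefold.mem_eigenspace_colour₁_iff hd hφY hcc, pullInl_pullSnd_baseChange, pullInr_pullSnd_baseChange]
    exact ⟨rfl, hb₁⟩
  · rw [CMCurveFivefold.mem_eigenspace_colour₁_iff hd hφY hcc', pullInl_pullSnd_baseChange, pullInr_pullSnd_baseChange]
    exact ⟨rfl, hb₂⟩

end BlockData

end Literature.AlgebraicGeometry.HodgeTheory

end
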